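import Summits.ValiantsHypothesis.ValiantsHypothesis.Theorems.SymPencilPerFourPeeledTenCaseA
import Summits.ValiantsHypothesis.ValiantsHypothesis.Theorems.SymPencilPerFourPeeledTransport

/-!
# Route `SymPencil` — inner rank of the `2 | 2` row split of `per_4`: the PEELED case at `|κ| = 10`
# is impossible whenever three row-`𝟙` coefficients of the `a`-block are pairwise distinct and
# non-zero (`--supports` stmt-ValiantsHypothesis-5674 `SdcSuperquadratic`; (8,8) column, memo
# `NOTE-p6g16-5674-R2-peeled-ten.md` §2)

`false_of_peeled_ten_generic`: `false_of_peeled_ten_caseA` transported along a coordinate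
permutation `π` (`…PeeledTransport.transport_perm`): if `h (π⁻¹ 0), h (π⁻¹ 1), h (π⁻¹ 2)` are
pairwise distinct and non-zero, a peeled reduced family with `|κ| = 10` does not exist.  The
residual patterns of `h` (every triple has a repeat or a zero) are NOT covered here.  Honest framing:
conditional step toward cell (8,8,10); no cell closes; `27 ≤ sdc(per_4) ≤ 29`, the crux and
`VP ≠ VNP` untouched.  No definitions, no named facts. [folklore]
-/

noncomputable section

-- single-conjunct layout: Sub = Summit, duplicated namespace component intended
set_option linter.dupNamespace false

namespace Summit.ValiantsHypothesis.ValiantsHypothesis.Theorems.SymPencilPerFourPeeledTenGeneric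

open Matrix Finset
open Summit.ValiantsHypothesis.ValiantsHypothesis.Theorems.SymPencilPerFourPeeledTenCaseA
open Summit.ValiantsHypothesis.ValiantsHypothesis.Theorems.SymPencilPerFourPeeledTransport

universe u v

variable {K : Type u} [Field K]

/-- **The peeled case at `|κ| = 10` with a good triple of row-`𝟙` coefficients is impossible.**
[folklore] -/
theorem false_of_peeled_ten_generic [CharZero K] {κ : Type v} [Fintype κ] [DecidableEq κ]
    (hκ : Fintype.card κ = 10) (c : κ → K) (hc : ∀ r, c r ≠ 0)
    (t : κ → (((Fin 4 → K) × (Fin 4 → K)) →ₗ[K] ((Fin 4 → K) × (Fin 4 → K)) →ₗ[K] K))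
    (hJ : ∀ a b y₂ y₃ : Fin 4 → K,
      ∑ r, c r * (t r (a, b) (y₂, y₃)) ^ 2 = (Matrix.of ![a, b, y₂, y₃]).permanent)
    (v₀ v₀' : κ → K) (hv₀ : ∀ (a x : Fin 4 → K), ∃ s : K, (fun r => t r (a, 0) (x, 0)) = s • v₀)
    (hv₀' : ∀ (b x : Fin 4 → K), ∃ s : K, (fun r => t r (0, b) (0, x)) = s • v₀')
    (hpeel : ∃ a b y z : Fin 4 → K, ∑ r, c r * t r (a, 0) (y, 0) * t r (0, b) (0, z) ≠ 0)
    (h : Fin 4 → K) (hh : ∀ k r, t r ((fun _ => 1), 0) (Pi.single k 1, 0) = h k * v₀ r)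
    (π : Equiv.Perm (Fin 4))
    (h0 : h (π.symm 0) ≠ 0) (h1 : h (π.symm 1) ≠ 0) (h2 : h (π.symm 2) ≠ 0)
    (h01 : h (π.symm 0) ≠ h (π.symm 1)) (h02 : h (π.symm 0) ≠ h (π.symm 2))
    (h12 : h (π.symm 1) ≠ h (π.symm 2)) : False := by
  obtain ⟨t', hJ', hw₀, hw₀', hpeel', hh'⟩ := transport_perm π c t hJ v₀ v₀' hv₀ hv₀' hpeel h hh
  exact false_of_peeled_ten_caseA hκ c hc t' hJ' v₀ v₀' hw₀ hw₀' hpeel' (h ∘ π.symm)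
    (fun k r => hh' k r) h0 h1 h2 h01 h02 h12

/-- **Index-free form.**  If some three coordinates `i, j, k` of `h` are pairwise distinct and
non-zero, the peeled reduced family with `|κ| = 10` does not exist. [folklore] -/
theorem false_of_peeled_ten_of_triple [CharZero K] {κ : Type v} [Fintype κ] [DecidableEq κ]
    (hκ : Fintype.card κ = 10) (c : κ → K) (hc : ∀ r, c r ≠ 0)
    (t : κ → (((Fin 4 → K) × (Fin 4 → K)) →ₗ[K] ((Fin 4 → K) × (Fin 4 → K)) →ₗ[K] K))
    (hJ : ∀ a b y₂ y₃ : Fin 4 → K,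
      ∑ r, c r * (t r (a, b) (y₂, y₃)) ^ 2 = (Matrix.of ![a, b, y₂, y₃]).permanent)
    (v₀ v₀' : κ → K) (hv₀ : ∀ (a x : Fin 4 → K), ∃ s : K, (fun r => t r (a, 0) (x, 0)) = s • v₀)
    (hv₀' : ∀ (b x : Fin 4 → K), ∃ s : K, (fun r => t r (0, b) (0, x)) = s • v₀')
    (hpeel : ∃ a b y z : Fin 4 → K, ∑ r, c r * t r (a, 0) (y, 0) * t r (0, b) (0, z) ≠ 0)
    (h : Fin 4 → K) (hh : ∀ k r, t r ((fun _ => 1), 0) (Pi.single k 1, 0) = h k * v₀ r)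
    (i j k : Fin 4) (hij : i ≠ j) (hik : i ≠ k) (hjk : j ≠ k)
    (hi : h i ≠ 0) (hj : h j ≠ 0) (hk : h k ≠ 0)
    (hij' : h i ≠ h j) (hik' : h i ≠ h k) (hjk' : h j ≠ h k) : False := by
  -- the permutation with `π⁻¹ 0 = i`, `π⁻¹ 1 = j`, `π⁻¹ 2 = k`
  obtain ⟨l, hl⟩ : ∃ l : Fin 4, l ≠ i ∧ l ≠ j ∧ l ≠ k := by
    by_contra hc; push Not at hc
    have h4 : ∀ l : Fin 4, l = i ∨ l = j ∨ l = k := fun l => by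
      by_cases h1 : l = i; · exact Or.inl h1
      by_cases h2 : l = j; · exact Or.inr (Or.inl h2)
      exact Or.inr (Or.inr (hc l h1 h2))
    -- four elements cannot all lie in a three-element set
    have := Fintype.card_le_of_surjective (fun x : Fin 3 => (![i, j, k] x : Fin 4)) (fun l => by
      rcases h4 l with h | h | h
      · exact ⟨0, h.symm⟩
      · exact ⟨1, h.symm⟩
      · exact ⟨2, h.symm⟩)
    simp at this
  let f : Fin 4 → Fin 4 := ![i, j, k, l]
  have hf : Function.Injective f := by
    intro x y hxy
    fin_cases x <;> fin_cases y <;> simp [f] at hxy ⊢ <;> first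
      | rfl | exact absurd hxy hij | exact absurd hxy.symm hij | exact absurd hxy hik
      | exact absurd hxy.symm hik | exact absurd hxy hjk | exact absurd hxy.symm hjk
      | exact absurd hxy.symm hl.1 | exact absurd hxy hl.1 | exact absurd hxy.symm hl.2.1
      | exact absurd hxy hl.2.1 | exact absurd hxy.symm hl.2.2 | exact absurd hxy hl.2.2
  let σ : Equiv.Perm (Fin 4) := Equiv.ofBijective f (Finite.injective_iff_bijective.1 hf)
  have hσ0 : σ 0 = i := rfl
  have hσ1 : σ 1 = j := rfl
  have hσ2 : σ 2 = k := rfl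
  refine false_of_peeled_ten_generic hκ c hc t hJ v₀ v₀' hv₀ hv₀' hpeel h hh σ.symm ?_ ?_ ?_ ?_ ?_ ?_
  all_goals simp only [Equiv.symm_symm, hσ0, hσ1, hσ2]
  all_goals assumption

end Summit.ValiantsHypothesis.ValiantsHypothesis.Theorems.SymPencilPerFourPeeledTenGeneric

end
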